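import Literature.AlgebraicGeometry.Morphisms.CechUnitCocycleDifferenceClass
import HarnessLib

/-!
# Unit Čech cocycles along a small extension with ARBITRARY residue algebra: lifts of a line bundle on a flat
# `X/R` differ by a Čech `1`-cocycle of the fibre (Görtz–Wedhorn II, Lemma 26.15; Hartshorne, *Deformation Theory*, Thm. 6.4 (b))

Layer `Literature/AlgebraicGeometry/Morphisms`, namespace `Literature.AlgebraicGeometry.Morphisms.CechUnitCocycle`.
THEOREMS ONLY (no definition — the difference cochain is quantified with its defining relation —, no named fact, no instance,
no notation).  Cell `hodgecm-mathlib`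
(D-0151), price-sheet row F-2d, road (R-def) «theorem of the cube over a NON-reduced base by Artinian induction», Step (I)
brick Č1 (author B-p07 (g15); B-plan1 (g15) 2026-08-30T03:13Z GO on the slice step; census
`B-provers/B-p07/g15/CENSUS-F2d-CubeOverBase.B-p07g15.md`).

★ `Morphisms/CechUnitCocycleSmallExtension` / `…DifferenceClass` (M13 N3) type [GortzWedhorn2023] Lemma 26.15 / [Hartshorne2010]
Thm. 6.4 (b) in Čech form for an AUGMENTED small extension `π : R ↠ R₀`, `ρ : R ↠ A` OF `A`-ALGEBRAS — the residue ring IS the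
base ring `A` of the scheme `f : X → Spec A`, so the flat models `Γ(V) ⊗_A R` are those of the TRIVIAL deformation
`X ×_A Spec R` of `X`.  This file removes that restriction: the residue ring is any `A`-algebra `k` (`ρ : R ↠ k`, kernel of
`π` framed by `e : k^d ≅ I`, ★ `RingTheory/Flat/SmallExtensionBaseChange.IsSmallExtension` in its full generality), so that
`X ×_A Spec R ↠ X ×_A Spec k` is an ARBITRARY flat deformation of the fibre `X_k` when `X/A` is flat (e.g. `A = 𝒪_{S,s}`,
`R = A/𝔪^{n+2} ↠ R₀ = A/𝔪^{n+1}`, `k = κ(s)`: the infinitesimal neighbourhoods of a fibre of a flat `X → S`, NOT a constant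
family).  The difference of two lifts then lives in the Čech cochains of the RESIDUE MODELS `Γ(V) ⊗_A k` (= `Γ(V_k, 𝒪_{X_k})` for
affine `V`), the Čech `1`-cochains of `𝒪_{X_k}` — [Hartshorne2010] Thm. 6.4 (b) «`H¹(J ⊗_C 𝒪_X)` acts transitively on the set
of isomorphism classes of such `𝓛'`» with `J ⊗ 𝒪_X = 𝒪_{X₀}^d` by flatness, in cocycle form.

Setting: `f : X ⟶ Spec A`, a family of opens `U`, `A`-algebras `R ↠ R₀`, `R ↠ k` with `H : IsSmallExtension π ρ I e`,
`ρ₀ : R₀ → k` with `ρ₀ ∘ π = ρ`; unit cocycles `u, u' : UCocycle f U R` (★ `CechUnitCocycleCoefficients`, transition functions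
of line bundles on `X ×_A Spec R` trivialised on the `U_i × Spec R`); `[∀ V, Module.Flat A (Sections f V)]` where uniqueness
is needed (e.g. `X/A` flat and the `U_i`, `U_i ∩ U_j` affine, or `A` a field).

* §1 the kernel map `κ_V : (Γ(V) ⊗_A k)^d → Γ(V) ⊗_A R` of ★ `IsSmallExtension.kerMap` read on the models: restriction
  (`resR_kerMap`), reductions (`coef_π_kerMap`, `coef_ρ_kerMap`), exactness (`exists_kerMap_eq_of_coef_eq_zero`), `I² = 0`
  (`kerMap_mul_kerMap_eq_zero`, `one_add_kerMap_mul`, `isUnit_one_add_kerMap`), `exists_eq_one_add_kerMap`, `isUnit_of_isUnit_coef`.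
* §2 `existsUnique_diffK` — two units with the same reduction differ by `1 + κ y` for a UNIQUE `y ∈ (Γ(V) ⊗_A k)^d`;
  **`existsUnique_diffCochainK u u'`** — a unique DIFFERENCE COCHAIN `η ∈ ((Č¹ of the residue models)^d)` with
  `u'_{ij} = u_{ij}(1 + κ η_{ij})`; **`diffCochainK_cocycle`** — any such `η` is a `d`-tuple of Čech `1`-COCYCLES of the
  residue models (`η_{jk}| − η_{ik}| + η_{ij}| = 0`); `diffCochainK_self/_trans/_symm` (chain rules).
* §3 **`exists_rel_of_diffCochainK_eq_cechD0`** — if every `η_ℓ` is a Čech COBOUNDARY of the residue models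
  (`η_ℓ ij = β_ℓ j| − β_ℓ i|`) then `u'` is obtained from `u` by a unit `0`-cochain reducing to `1` along `π` (★ `Rel`); and the
  converse **`exists_eq_cechD0_of_rel`**; `exists_twist_sameRed'` (normalising a lift whose reduction is only cohomologous).

HC_CM is proved only modulo the 7 printed citations until rung 0 closes; nothing here is about HC.

## References
* [GortzWedhorn2023] U. Görtz, T. Wedhorn, *Algebraic Geometry II* (2023), Lemma 26.15 (`H¹(X₀, 𝓘) → Pic X → Pic X₀`), Lemma 24.72
  proof Step (I) (p. 549).
* [Hartshorne2010] R. Hartshorne, *Deformation Theory*, GTM 257 (2010), §6 Thm. 6.4 (b) and proof (pp. 50–51).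
* [StacksProject] The Stacks Project, Tag 08SP (deformations of invertible modules), Tag 01ED (Čech cohomology).
-/

noncomputable section

universe u v

open TensorProduct CategoryTheory AlgebraicGeometry
open Literature.RingTheory.Flat Literature.RingTheory.Flat.IsSmallExtension

namespace Literature.AlgebraicGeometry.Morphisms

namespace CechUnitCocycle

variable {A : Type u} [CommRing A] {X : Scheme.{u}} {f : X ⟶ Spec (.of A)} {ι : Type v} {U : ι → X.Opens}
variable {R R₀ k : Type u} [CommRing R] [CommRing R₀] [CommRing k] [Algebra A R] [Algebra A R₀] [Algebra A k]
  {π : R →ₐ[A] R₀} {ρ : R →ₐ[A] k} {I : Ideal R} {d : ℕ} {e : (Fin d → k) ≃ₗ[A] I}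

/-! ## §1 The kernel map on the models `Γ(V) ⊗_A R`, residue models `Γ(V) ⊗_A k` -/

section KerMap

variable (f e)

/-- **Restriction commutes with the kernel map**: `(κ y)|_W = κ (y|_W)` in the models (★ `map_kerMap` along `Γ(V) → Γ(W)`).
[cite: GortzWedhorn2023, Lemma 26.15] -/
theorem resR_kerMap {V W : X.Opens} (h : W ≤ V) (y : Fin d → Sections f V ⊗[A] k) :
    resR f R h (kerMap e (Sections f V) y) = kerMap e (Sections f W) (fun ℓ => resR f k h (y ℓ)) :=
  map_kerMap (e := e) (Sections f V) (Sections.res f h) y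

/-- **Injectivity** of the kernel map on `Γ(V)` flat over `A` (★ `kerMap_injective`). [cite: StacksProject, Tag 00HL] -/
theorem kerMap_sections_injective (V : X.Opens) [Module.Flat A (Sections f V)] :
    Function.Injective (kerMap e (Sections f V)) :=
  kerMap_injective (e := e) (Sections f V)

variable {f e} (H : IsSmallExtension π ρ I e)
include H

/-- `id ⊗ π` kills the kernel map. [cite: GortzWedhorn2023, Lemma 26.15] -/
theorem coef_π_kerMap (V : X.Opens) (y : Fin d → Sections f V ⊗[A] k) : coef f π V (kerMap e (Sections f V) y) = 0 :=
  H.mapπ_kerMap (Sections f V) y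

/-- **Exactness**: an element of `Γ(V) ⊗_A R` killed by `id ⊗ π` is `κ y`. [cite: GortzWedhorn2023, Lemma 26.15] -/
theorem exists_kerMap_eq_of_coef_eq_zero {V : X.Opens} {x : Sections f V ⊗[A] R} (hx : coef f π V x = 0) :
    ∃ y : Fin d → Sections f V ⊗[A] k, kerMap e (Sections f V) y = x :=
  H.exists_kerMap_eq_of_mapπ_eq_zero (Sections f V) hx

/-- **Semilinearity**: `x · κ y = κ (x̄ · y)`, `x̄ = (id ⊗ ρ) x ∈ Γ(V) ⊗_A k`. [cite: GortzWedhorn2023, Lemma 26.15] -/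
theorem mul_kerMap_sections (V : X.Opens) (x : Sections f V ⊗[A] R) (y : Fin d → Sections f V ⊗[A] k) :
    x * kerMap e (Sections f V) y = kerMap e (Sections f V) (fun ℓ => coef f ρ V x * y ℓ) :=
  H.mul_kerMap (Sections f V) x y

variable {ρ₀ : R₀ →ₐ[A] k} (hρ : ρ₀.comp π = ρ)
include hρ

/-- `id ⊗ ρ` kills the kernel map (`I ⊆ ker ρ`). [cite: GortzWedhorn2023, Lemma 26.15] -/
theorem coef_ρ_kerMap (V : X.Opens) (y : Fin d → Sections f V ⊗[A] k) : coef f ρ V (kerMap e (Sections f V) y) = 0 := by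
  rw [← hρ, coef_comp, coef_π_kerMap H, map_zero]

/-- **`I² = 0`**: `κ y · κ y' = 0`. [cite: GortzWedhorn2023, Lemma 26.15] -/
theorem kerMap_mul_kerMap_eq_zero (V : X.Opens) (y y' : Fin d → Sections f V ⊗[A] k) :
    kerMap e (Sections f V) y * kerMap e (Sections f V) y' = 0 := by
  rw [mul_kerMap_sections H, coef_ρ_kerMap H hρ]
  have : (fun ℓ => (0 : Sections f V ⊗[A] k) * y' ℓ) = 0 := by funext ℓ; simp
  rw [this, map_zero]

/-- `(1 + κ y)(1 + κ y') = 1 + κ (y + y')`. [cite: GortzWedhorn2023, Lemma 26.15] -/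
theorem one_add_kerMap_mul (V : X.Opens) (y y' : Fin d → Sections f V ⊗[A] k) :
    (1 + kerMap e (Sections f V) y) * (1 + kerMap e (Sections f V) y') = 1 + kerMap e (Sections f V) (y + y') := by
  rw [map_add]
  have h0 := kerMap_mul_kerMap_eq_zero H hρ V y y'
  calc (1 + kerMap e (Sections f V) y) * (1 + kerMap e (Sections f V) y')
      = 1 + kerMap e _ y + kerMap e _ y' + kerMap e _ y * kerMap e _ y' := by ring
    _ = 1 + (kerMap e _ y + kerMap e _ y') := by rw [h0]; ring

/-- `1 + κ y` is a unit (inverse `1 − κ y`). [cite: GortzWedhorn2023, Lemma 26.15] -/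
theorem isUnit_one_add_kerMap (V : X.Opens) (y : Fin d → Sections f V ⊗[A] k) : IsUnit (1 + kerMap e (Sections f V) y) := by
  refine IsUnit.of_mul_eq_one (1 + kerMap e (Sections f V) (-y)) ?_
  rw [one_add_kerMap_mul H hρ, add_neg_cancel, map_zero, add_zero]

omit hρ in
/-- An element reducing to `1` along `π` is `1 + κ y`. [cite: GortzWedhorn2023, Lemma 26.15] -/
theorem exists_eq_one_add_kerMap {V : X.Opens} {x : Sections f V ⊗[A] R} (hx : coef f π V x = 1) :
    ∃ y : Fin d → Sections f V ⊗[A] k, x = 1 + kerMap e (Sections f V) y := by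
  obtain ⟨y, hy⟩ := exists_kerMap_eq_of_coef_eq_zero H (x := x - 1) (by rw [map_sub, hx, map_one, sub_self])
  exact ⟨y, by rw [hy]; ring⟩

/-- An element reducing to a unit along `π` is a unit (★ `isUnit_of_isUnit_mapρ`). [cite: GortzWedhorn2023, Lemma 26.15] -/
theorem isUnit_of_isUnit_coef {V : X.Opens} {x : Sections f V ⊗[A] R} (hx : IsUnit (coef f π V x)) : IsUnit x := by
  refine H.isUnit_of_isUnit_mapρ (Sections f V) ?_
  have : mapρ ρ (Sections f V) x = coef f ρ₀ V (coef f π V x) := by rw [← coef_comp, hρ]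
  rw [this]
  exact hx.map _

end KerMap

/-! ## §2 The difference cochain of two lifts, with values in the residue models -/

section Diff

variable (H : IsSmallExtension π ρ I e) {ρ₀ : R₀ →ₐ[A] k} (hρ : ρ₀.comp π = ρ)
variable [∀ V : X.Opens, Module.Flat A (Sections f V)]

include H

/-- **Two units with the same reduction differ by `1 + κ y` for a unique `y ∈ (Γ(V) ⊗_A k)^d`.**
[cite: GortzWedhorn2023, Lemma 26.15] [cite: Hartshorne2010, §6 Thm. 6.4 (b) and proof (pp. 50–51)] -/
theorem existsUnique_diffK {V : X.Opens} {x x' : Sections f V ⊗[A] R} (hx : IsUnit x) (hred : coef f π V x' = coef f π V x) :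
    ∃! y : Fin d → Sections f V ⊗[A] k, x' = x * (1 + kerMap e (Sections f V) y) := by
  set xi : Sections f V ⊗[A] R := ↑hx.unit⁻¹ with hxi
  have hxi1 : xi * x = 1 := hx.val_inv_mul
  have hxi2 : x * xi = 1 := hx.mul_val_inv
  obtain ⟨y, hy⟩ := exists_kerMap_eq_of_coef_eq_zero H (V := V) (x := xi * x' - 1) (by
    rw [map_sub, map_mul, hred, ← map_mul, hxi1, map_one, sub_self])
  have key : x' = x * (1 + (xi * x' - 1)) := by rw [add_sub_cancel, ← mul_assoc, hxi2, one_mul]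
  refine ⟨y, ?_, fun y' hy' => ?_⟩
  · show x' = x * (1 + kerMap e (Sections f V) y)
    rw [hy]; exact key
  have hy'' : x' = x * (1 + kerMap e (Sections f V) y') := hy'
  refine kerMap_sections_injective f e V ?_
  have h1 : x * (1 + kerMap e _ y') = x * (1 + kerMap e _ y) := by rw [← hy'', hy]; exact key
  exact add_left_cancel ((hx.mul_right_inj).1 h1)

/-- **The difference cochain EXISTS AND IS UNIQUE**: for two unit cocycles `u, u'` over `R` with the same reduction along `π`
there is a unique `η ∈ ((Č¹ of the residue models)^d)`, `η_{ij} ∈ (Γ(U_i ∩ U_j) ⊗_A k)^d`, with `u'_{ij} = u_{ij} (1 + κ η_{ij})`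
for all `i, j` (THEOREMS ONLY: no `choose`d definition; consumers quantify over `η` with this defining relation).
[cite: GortzWedhorn2023, Lemma 26.15] [cite: Hartshorne2010, §6 Thm. 6.4 (b) and proof (pp. 50–51)]
(Edition note: the hypothesis `[∀ V : X.Opens, Module.Flat A (Sections f V)]` of this head holds when `A` is a field but is vacuous for a non-constant flat family `X/Spec A`; use `exists_diffCochainK` / `diffCochainK_unique` of `CechUnitCocycleResidueAffineCover`, which assumes flatness of the sections over the affine opens of the cover only.) -/
theorem existsUnique_diffCochainK (u u' : UCocycle f U R) (hred : SameRed u u' π) :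
    ∃! η : Fin d → (i j : ι) → Sections f (U i ⊓ U j) ⊗[A] k,
      ∀ i j, u'.val i j = u.val i j * (1 + kerMap e _ (fun ℓ => η ℓ i j)) := by
  have hex : ∀ i j, ∃! y : Fin d → Sections f (U i ⊓ U j) ⊗[A] k, u'.val i j = u.val i j * (1 + kerMap e _ y) :=
    fun i j => existsUnique_diffK H (u.isUnit i j) (hred i j)
  refine ⟨fun ℓ i j => (hex i j).exists.choose ℓ, fun i j => (hex i j).exists.choose_spec, fun η hη => ?_⟩
  funext ℓ i j
  exact congrFun ((hex i j).unique (hη i j) (hex i j).exists.choose_spec) ℓ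

include hρ

/-- **A difference cochain is a `d`-tuple of Čech `1`-COCYCLES of the residue models** (`η_{jl}| − η_{il}| + η_{ij}| = 0` on
`U_i ∩ U_j ∩ U_l`): the cocycle identities of `u`, `u'` and `I² = 0`. [cite: GortzWedhorn2023, Lemma 26.15]
[cite: Hartshorne2010, §6 Thm. 6.4 (b) and proof (pp. 50–51)]
(Edition note: the hypothesis `[∀ V : X.Opens, Module.Flat A (Sections f V)]` of this head holds when `A` is a field but is vacuous for a non-constant flat family `X/Spec A`; use `diffCochainK_cocycle_of_isAffineOpen` of `CechUnitCocycleResidueAffineCover`, which assumes flatness of the sections over the affine opens of the cover only.) -/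
theorem diffCochainK_cocycle (u u' : UCocycle f U R) (η : Fin d → (i j : ι) → Sections f (U i ⊓ U j) ⊗[A] k)
    (hη : ∀ i j, u'.val i j = u.val i j * (1 + kerMap e _ (fun ℓ => η ℓ i j))) (ℓ : Fin d) (i j l : ι) :
    resR f k (le23 (U := U) i j l) (η ℓ j l) - resR f k (le13 (U := U) i j l) (η ℓ i l) +
      resR f k (le12 (U := U) i j l) (η ℓ i j) = 0 := by
  -- restrict the defining relations to `U_{ijl}`
  have e12 := congrArg (resR f R (le12 (U := U) i j l)) (hη i j)
  have e23 := congrArg (resR f R (le23 (U := U) i j l)) (hη j l)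
  have e13 := congrArg (resR f R (le13 (U := U) i j l)) (hη i l)
  simp only [map_mul, map_add, map_one, resR_kerMap] at e12 e23 e13
  -- multiply: `u'_{ij}| u'_{jl}| = u'_{il}|`
  have hc' := u'.cocycle i j l
  rw [e12, e23, e13] at hc'
  have hu13 : IsUnit (resR f R (le13 (U := U) i j l) (u.val i l)) := (u.isUnit i l).map _
  rw [mul_mul_mul_comm, u.cocycle, one_add_kerMap_mul H hρ] at hc'
  have h2 := add_left_cancel ((hu13.mul_right_inj).1 hc')
  have h3 := congrFun (kerMap_sections_injective f e _ h2) ℓ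
  simp only [Pi.add_apply] at h3
  rw [← h3]; ring

omit H hρ [∀ V : X.Opens, Module.Flat A (Sections f V)] in
/-- `η = 0` is the difference cochain of `(u, u)`. [cite: GortzWedhorn2023, Lemma 26.15] -/
theorem diffCochainK_self (u : UCocycle f U R) (i j : ι) :
    u.val i j = u.val i j * (1 + kerMap e _ (fun ℓ => (0 : Fin d → (i j : ι) → Sections f (U i ⊓ U j) ⊗[A] k) ℓ i j)) := by
  change u.val i j = u.val i j * (1 + kerMap e _ (0 : Fin d → _)); rw [map_zero]; ring

omit [∀ V : X.Opens, Module.Flat A (Sections f V)] in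
/-- **Additivity in chains**: if `η` is a difference cochain of `(u, u')` and `η'` one of `(u', u'')`, then `η + η'` is one of
`(u, u'')`. [cite: GortzWedhorn2023, Lemma 26.15] -/
theorem diffCochainK_trans (u u' u'' : UCocycle f U R) (η η' : Fin d → (i j : ι) → Sections f (U i ⊓ U j) ⊗[A] k)
    (hη : ∀ i j, u'.val i j = u.val i j * (1 + kerMap e _ (fun ℓ => η ℓ i j)))
    (hη' : ∀ i j, u''.val i j = u'.val i j * (1 + kerMap e _ (fun ℓ => η' ℓ i j))) (i j : ι) :
    u''.val i j = u.val i j * (1 + kerMap e _ (fun ℓ => (η + η') ℓ i j)) := by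
  rw [hη' i j, hη i j, mul_assoc, one_add_kerMap_mul H hρ]
  rfl

omit [∀ V : X.Opens, Module.Flat A (Sections f V)] in
/-- Antisymmetry: `−η` is a difference cochain of `(u', u)`. [cite: GortzWedhorn2023, Lemma 26.15] -/
theorem diffCochainK_symm (u u' : UCocycle f U R) (η : Fin d → (i j : ι) → Sections f (U i ⊓ U j) ⊗[A] k)
    (hη : ∀ i j, u'.val i j = u.val i j * (1 + kerMap e _ (fun ℓ => η ℓ i j))) (i j : ι) :
    u.val i j = u'.val i j * (1 + kerMap e _ (fun ℓ => (-η) ℓ i j)) := by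
  rw [hη i j, mul_assoc, one_add_kerMap_mul H hρ]
  have : ((fun ℓ => η ℓ i j) + fun ℓ => (-η) ℓ i j) = 0 := by funext ℓ; simp
  rw [this, map_zero, add_zero, mul_one]

/-! ## §3 Zero class ⟺ cohomologous lifts -/

omit [∀ V : X.Opens, Module.Flat A (Sections f V)] in
/-- **Coboundary ⟹ cohomologous**: if a difference cochain `η` of `(u, u')` is, for every `ℓ`, the Čech coboundary
`β_ℓ j| − β_ℓ i|` of a `0`-cochain of the residue models, then `u'` is obtained from `u` by a unit `0`-cochain REDUCING TO `1`
along `π` (★ `Rel`) — the transitive action of `H¹(X₀, 𝒪)^d` on lifts, cocycle form. [cite: GortzWedhorn2023, Lemma 26.15]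
[cite: Hartshorne2010, §6 Thm. 6.4 (b) and proof (pp. 50–51)] -/
theorem exists_rel_of_diffCochainK_eq_cechD0 (u u' : UCocycle f U R)
    (η : Fin d → (i j : ι) → Sections f (U i ⊓ U j) ⊗[A] k)
    (hη : ∀ i j, u'.val i j = u.val i j * (1 + kerMap e _ (fun ℓ => η ℓ i j)))
    (β : Fin d → (i : ι) → Sections f (U i) ⊗[A] k)
    (hβ : ∀ ℓ i j, η ℓ i j =
      resR f k (inf_le_right : U i ⊓ U j ≤ U j) (β ℓ j) - resR f k (inf_le_left : U i ⊓ U j ≤ U i) (β ℓ i)) :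
    ∃ h : UCochain0 f U R, (∀ i, coef f π (U i) (h i : Sections f (U i) ⊗[A] R) = 1) ∧
      Rel u u' (fun i => (h i : Sections f (U i) ⊗[A] R)) := by
  -- `h_i := 1 − κ(β_·(i))`
  refine ⟨fun i => (isUnit_one_add_kerMap H hρ (U i) (fun ℓ => -β ℓ i)).unit, fun i => by
    rw [IsUnit.unit_spec, map_add, map_one, coef_π_kerMap H, add_zero], fun i j => ?_⟩
  simp only [IsUnit.unit_spec]
  rw [hη i j]
  simp only [map_add, map_one, resR_kerMap, map_neg]
  have hη' : (fun ℓ => η ℓ i j) =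
      fun ℓ => resR f k (inf_le_right : U i ⊓ U j ≤ U j) (β ℓ j) - resR f k (inf_le_left : U i ⊓ U j ≤ U i) (β ℓ i) := by
    funext ℓ; exact hβ ℓ i j
  rw [hη', mul_assoc, one_add_kerMap_mul H hρ, mul_comm]
  congr 3; funext ℓ; simp only [Pi.add_apply]; abel

/-- **Cohomologous ⟹ coboundary**: if `u'` is obtained from `u` by a `0`-cochain `h` reducing to `1` (so `SameRed u u' π`, ★
`sameRed_of_rel`), then every difference cochain `η` of `(u, u')` is a Čech COBOUNDARY of the residue models.
[cite: GortzWedhorn2023, Lemma 26.15] [cite: Hartshorne2010, §6 Thm. 6.4 (b) and proof (pp. 50–51)]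
(Edition note: the hypothesis `[∀ V : X.Opens, Module.Flat A (Sections f V)]` of this head holds when `A` is a field but is vacuous for a non-constant flat family `X/Spec A`; use `exists_eq_cechD0_of_rel_of_isAffineOpen` of `CechUnitCocycleResidueAffineCover`, which assumes flatness of the sections over the affine opens of the cover only.) -/
theorem exists_eq_cechD0_of_rel (u u' : UCocycle f U R) (h : (i : ι) → Sections f (U i) ⊗[A] R)
    (h1 : ∀ i, coef f π _ (h i) = 1) (hr : Rel u u' h)
    (η : Fin d → (i j : ι) → Sections f (U i ⊓ U j) ⊗[A] k)
    (hη : ∀ i j, u'.val i j = u.val i j * (1 + kerMap e _ (fun ℓ => η ℓ i j))) :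
    ∃ β : Fin d → (i : ι) → Sections f (U i) ⊗[A] k, ∀ ℓ i j,
      η ℓ i j = resR f k (inf_le_right : U i ⊓ U j ≤ U j) (β ℓ j) - resR f k (inf_le_left : U i ⊓ U j ≤ U i) (β ℓ i) := by
  -- `h_i = 1 + κ b_i`
  have hb : ∀ i, ∃ b : Fin d → Sections f (U i) ⊗[A] k, h i = 1 + kerMap e _ b := fun i => exists_eq_one_add_kerMap H (h1 i)
  choose b hb using hb
  have hred : SameRed u u' π := sameRed_of_rel u u' h h1 hr
  refine ⟨fun ℓ i => -b i ℓ, fun ℓ i j => ?_⟩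
  -- the cochain `b_i| − b_j|` satisfies the defining relation, hence equals `η` by uniqueness
  set bi : Fin d → Sections f (U i ⊓ U j) ⊗[A] k := fun ℓ => resR f k (inf_le_left : U i ⊓ U j ≤ U i) (b i ℓ)
  set bj : Fin d → Sections f (U i ⊓ U j) ⊗[A] k := fun ℓ => resR f k (inf_le_right : U i ⊓ U j ≤ U j) (b j ℓ)
  have hij := hr i j
  rw [hb i, hb j] at hij
  simp only [map_add, map_one, resR_kerMap] at hij
  have hinv : (1 + kerMap e _ bj) * (1 + kerMap e _ (-bj)) = 1 := by
    rw [one_add_kerMap_mul H hρ, add_neg_cancel, map_zero, add_zero]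
  have hrel : u'.val i j = u.val i j * (1 + kerMap e _ (bi + -bj)) :=
    calc u'.val i j = u'.val i j * ((1 + kerMap e _ bj) * (1 + kerMap e _ (-bj))) := by rw [hinv, mul_one]
      _ = ((1 + kerMap e _ bi) * u.val i j) * (1 + kerMap e _ (-bj)) := by rw [← mul_assoc, ← hij]
      _ = u.val i j * ((1 + kerMap e _ bi) * (1 + kerMap e _ (-bj))) := by ring
      _ = u.val i j * (1 + kerMap e _ (bi + -bj)) := by rw [one_add_kerMap_mul H hρ]
  have huniq := (existsUnique_diffK H (u.isUnit i j) (hred i j)).unique (hη i j) hrel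
  have hℓ := congrFun huniq ℓ
  simp only [Pi.add_apply, Pi.neg_apply, bi, bj] at hℓ
  rw [hℓ]; simp only [map_neg]; abel

omit hρ [∀ V : X.Opens, Module.Flat A (Sections f V)] in
/-- **NORMALISATION OF A LIFT** (★ `exists_twist_sameRed` for the present binders): if the reduction of `w` is related to
the reduction of `u` by a unit `0`-cochain `h₀` over `R₀`, the twist of `w` by a lift of `h₀` has THE SAME reduction as `u`.
[cite: GortzWedhorn2023, Lemma 26.15] -/
theorem exists_twist_sameRed' (hρ : ρ₀.comp π = ρ) (u w : UCocycle f U R) (h₀ : UCochain0 f U R₀)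
    (hr : Rel (w.map π) (u.map π) (fun i => ↑(h₀ i))) :
    ∃ h : UCochain0 f U R, (∀ i, coef f π (U i) (h i : Sections f (U i) ⊗[A] R) = ↑(h₀ i)) ∧
      SameRed u (w.twist h) π := by
  -- lift `h₀` along the surjection `id ⊗ π`
  have hl : ∀ i, ∃ x : Sections f (U i) ⊗[A] R, coef f π _ x = ↑(h₀ i) := fun i =>
    H.mapπ_surjective (Sections f (U i)) _
  choose x hx using hl
  have hxu : ∀ i, IsUnit (x i) := fun i =>
    isUnit_of_isUnit_coef H hρ (by rw [hx i]; exact (h₀ i).isUnit)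
  refine ⟨fun i => (hxu i).unit, fun i => by rw [IsUnit.unit_spec, hx i], fun i j => ?_⟩
  have hinv : ∀ i, coef f π (U i) ((hxu i).unit⁻¹ : (Sections f (U i) ⊗[A] R)ˣ) =
      (((h₀ i)⁻¹ : (Sections f (U i) ⊗[A] R₀)ˣ) : Sections f (U i) ⊗[A] R₀) := fun i => by
    have h1 : coef f π (U i) ((hxu i).unit⁻¹ : (Sections f (U i) ⊗[A] R)ˣ) * (h₀ i : Sections f (U i) ⊗[A] R₀) = 1 := by
      rw [← hx i, ← map_mul, IsUnit.val_inv_mul, map_one]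
    calc coef f π (U i) ((hxu i).unit⁻¹ : (Sections f (U i) ⊗[A] R)ˣ)
        = coef f π (U i) ((hxu i).unit⁻¹ : (Sections f (U i) ⊗[A] R)ˣ) *
            ((h₀ i : Sections f (U i) ⊗[A] R₀) * (((h₀ i)⁻¹ : (Sections f (U i) ⊗[A] R₀)ˣ) : Sections f (U i) ⊗[A] R₀)) := by
          rw [Units.mul_inv, mul_one]
      _ = (((h₀ i)⁻¹ : (Sections f (U i) ⊗[A] R₀)ˣ) : Sections f (U i) ⊗[A] R₀) := by rw [← mul_assoc, h1, one_mul]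
  rw [UCocycle.twist_val, map_mul, map_mul, ← resR_coef, ← resR_coef, IsUnit.unit_spec, hx i, hinv j]
  have hij := hr i j
  simp only [UCocycle.map_val] at hij
  calc resR f R₀ inf_le_left ↑(h₀ i) * coef f π _ (w.val i j) * resR f R₀ inf_le_right ↑(h₀ j)⁻¹
      = coef f π _ (u.val i j) * (resR f R₀ (inf_le_right : U i ⊓ U j ≤ U j) ↑(h₀ j) *
          resR f R₀ inf_le_right ↑(h₀ j)⁻¹) := by rw [hij, mul_assoc]
    _ = coef f π _ (u.val i j) := by rw [UCocycle.res_mul_inv, mul_one]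

end Diff

end CechUnitCocycle

end Literature.AlgebraicGeometry.Morphisms

end
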